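import Summits.HodgeConjecture.CorCM.D2Bridge.ClosedPrintedMuKeyIdentLemD3DelRecConjOmegaT
import Summits.HodgeConjecture.HodgeConjecture.Theses.HCCMUnconditional      -- v2: the ROUTE FILE (crux HD3 = stmt-HodgeConjecture-24837; pack decls of record by name)
import Summits.HodgeConjecture.CorCM.HypD3.A4LiuD3Items                         -- v2: A-p05 `famAtV` + the five v2 STUB TYPES at e₁ with (D1) fact binders, in THIS namespace (director 03:35:08Z (1))
import Summits.HodgeConjecture.CorCM.HypD3.A4LiuD3SameClassChiNonsplit          -- v2: A-p05 p602107 `HypD3.sameClassChiOfIsoNonsplit` (stub :185 CLOSED BY NAME)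
import Summits.HodgeConjecture.CorCM.HypD3.A4LiuD3SameClassOfSplit               -- v2: B-p18 p600298 `HypD3.sameClassOfSplit` (stub :199 CLOSED BY NAME at e₁)
import Summits.HodgeConjecture.CorCM.HypD3.A4LiuD3MuOfIsoNonsplitOfFacts       -- v2: B-p14 p603508 `HypD3.muOfIsoNonsplit_of_facts` (stub :190 CLOSED BY NAME modulo hK)
import Summits.HodgeConjecture.CorCM.HypD3.A4LiuD3SplitInjectiveOfFacts        -- v2: B-p18 p602388 `HypD3.splitInjective_of_facts` (stub :195 CLOSED BY NAME modulo hK)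
import Summits.HodgeConjecture.CorCM.HypD3.A4LiuD3KudlaOfLineRigidity          -- v4: B-p18 p605088 `HypD3.kudla_of_lineRigidity` (place-free hK from S6a; :190/:195)
import Summits.HodgeConjecture.CorCM.HypD3.A4LiuD3IsoOfParamsOfLineRigidity    -- v4: B-p09 F9b p605777 `HypD3.isoOfParams_of_lineRigidityS6a` (:203 from S6a)
import Summits.HodgeConjecture.CorCM.HypD3.A4LiuD3LineRigidityS6a              -- v6: B-p14 p606846 `HypD3.lineRigidityS6a` HYPOTHESIS-FREE (over B-p13 F8b-3 MAIN p606519 + B-p02 F8a): S6a CLOSED BY NAME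
import Literature.NumberTheory.Automorphic.Liu2021.SplitPlaceOscillatorModelUniform            -- v2: IV-3(a) `splitPlace_chiCoinv_iso_parabolicIndGL_holds` (B-p08)
import Literature.NumberTheory.Automorphic.Zelevinsky1980.UnitaryCharacterInductionIrreducible  -- v2: IV-3(b) `parabolicIndGL_detChar_unitary_isIrreducible_holds` (B-p09 p601139)
import Literature.RepresentationTheory.MoeglinVignerasWaldspurger1987.RankOneThetaLiftTwistRigiditySplitHolds  -- v2: IV-4(c4) `rankOne_theta_twist_rigidity_split_holds` (B-p17)
import Literature.RepresentationTheory.MoeglinVignerasWaldspurger1987.RankOneThetaLiftLinesDisjointHolds          -- v5: IV-4(c1) `rankOne_theta_lines_disjoint_holds` (B-p10 p606332 over B-p17 P3 p606171 / B-p01 P4 / A-p15 interface): c1 CLOSED BY NAME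
import Literature.RepresentationTheory.MoeglinVignerasWaldspurger1987.RankOneThetaLiftTwistRigidityHolds  -- v7: IV-4(c3) `rankOne_theta_twist_rigidity_holds` (B-p18 p613492, route R `rankOne_theta_twist_rigidity_of_nonPeriodic₁₁'` ∘ `nonPeriodic₁₁_of_torusTrace` ∘ TR∕H1): c3 CLOSED BY NAME
import Summits.HodgeConjecture.CorCM.B01.Transposition.Item6OmegaChiSplitting
import Literature.NumberTheory.Automorphic.Liu2021.Def411WeilCarriersLocalDataAtV
import Literature.NumberTheory.Automorphic.IdeleClassCharacterHecke
import Literature.RepresentationTheory.Liu2021.OscillatorConventions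
import Literature.NumberTheory.GelbartRogawski1991.CMSplittingCharLocalMu
import HarnessLib

/-!
**v2 (A-plan2 g1, 2026-08-28 — REGISTRATION EDITION = the crux workfile `Cruxes/HD3/Lines/a4_liuD3.lean` on stmt-HodgeConjecture-24837).**  CONTENT DELTA vs v1 (5422b04d6cb4d0fa, REF1 PASS 02:57:41Z), exactly director RULINGS 02:54:52Z + 02:58:23Z: (a) `e ↦ e₁` — the five stub Props are stated at `e₁ = Equiv.prodUnique` only (binder `(e : Fin 3 × Fin 1 ≃ Fin 3)` deleted; `famAtV` keeps `e`); (b) (D1) FACT THREADING — the «⇒» stub Props take the IV-4c named facts they consume as EXPLICIT LEADING HYPOTHESES: `SameClassChiOfIsoNonsplit := rankOne_theta_lines_disjoint → ∀ F …` (c1), `MuOfIsoNonsplit := rankOne_theta_lines_disjoint → rankOne_theta_twist_rigidity → ∀ F …` (c1, c3), `SplitInjective := rankOne_theta_twist_rigidity_split → ∀ F …` (c4); `famAtV` and the five Props are now the TREE decls of `Summits/HodgeConjecture/CorCM/HypD3/A4LiuD3Items.lean` (A-p05, same namespace, imported — not copied); `lemD1_3AsPrintedI_famAtV_of` / `HypD3_of`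 take the three facts as extra arguments and the registration head `HD3_proof : ….HCCMUnconditional.HD3` carries them as RESIDUAL FACT STUBS (`stub_rankOne_theta_lines_disjoint`, `stub_rankOne_theta_twist_rigidity`, `stub_rankOne_theta_twist_rigidity_split`); local copy of `HypD3` DELETED (pack decl by name).  SLOTS FILLED BY NAME: :185 `stub_sameClass_and_chi_of_iso_nonsplit := HypD3.sameClassChiOfIsoNonsplit` (A-p05 p602107), :199 `stub_sameClass_of_split := fun F => HypD3.sameClassOfSplit F e₁` (B-p18 p600298).  (c) (A-plan2, ~03:58Z, after p602388/p603508/IV-3a/IV-4c4 landed) :190 `stub_mu_of_iso_nonsplit` and :195 `stub_splitInjective` are CLOSED BY NAME (`HypD3.muOfIsoNonsplit_of_facts` B-p14 p603508; `HypD3.splitInjective_of_facts` B-p18 p602388 fed with the PROVED IV-3(a) `splitPlace_chiCoinv_iso_parabolicIndGL_holds` and IV-3(b) `parabolicIndGL_detChar_unitary_isIrreducible_holds`) MODULO ONE NEW REGISTERED RESIDUAL `stub_kudlaTransportedSectionEq : KudlaTransportedSectionEq` (= the closers' common hypothesis `∀ i j, hK i j`, byte-identical in both, closed over the family binders; owner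 B-p13 S6a with B-p14 S6b/S6c), and c4 `stub_rankOne_theta_twist_rigidity_split := rankOne_theta_twist_rigidity_split_holds` (B-p17 over B-p08's `_uniform`).  **v3 (A-plan2, ~04:25Z): the uniform `hK` residual is CUT BY PLACE TYPE** — `stub_kudlaTransportedSectionEq` is now PROVED by `by_cases IsField (F ⊗ F⁺_v)` from the tree theorem `HypD3.kudla_nonsplit_of_lineRigidity` (A4LiuD3KudlaNonsplitOfLineRigidity.lean, 04:07Z) fed with the NEW registered residual `stub_lineRigidityS6a_nonsplit : LineRigidityS6aNonsplit` (= its hypothesis `hS6a` byte-identical, ∀-closed; B-p13's S6a) and the NEW registered residual `stub_kudlaTransportedSectionEq_split : KudlaTransportedSectionEqSplit` (`hK` under `¬ IsField`; B-p18/B-p14 split twins) — so the two halves land independently by name.  REGISTERED OPEN STUBS (5): `stub_lineRigidityS6a_nonsplit` (B-p13), `stub_kudlaTransportedSectionEq_split` (B-p18/B-p14), `stub_iso_of_params` (:203, B-p13), `stub_rankOne_theta_lines_disjoint` (c1, A-p15 P-pieces), `stub_rankOne_theta_twist_rigidity` (c3, WALL J7 cuspidal member).  Zero mathematical content added or removed.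  HC_CM is proved only modulo the 7 printed citations until rung 0 closes.  **v4 (A-plan2, ~05:15Z; director g2 04:40:16Z «hD3 = LineRigidityS6a + c1 + c3 exactly»; slot text B-p09 `B-provers/B-p09/a4_liuD3-v4-slots.B-p09.lean`): ONE PLACE-FREE RESIDUAL** — the two v3 place-type residuals `stub_lineRigidityS6a_nonsplit` / `stub_kudlaTransportedSectionEq_split` are REPLACED by the single registered residual `stub_lineRigidityS6a : LineRigidityS6a` (= `LineRigidityS6aNonsplit` with its `IsField (F ⊗ F⁺_v) →` line deleted = the `hS6a` binder of the tree theorems `HypD3.kudla_of_lineRigidity` (B-p18 p605088, A4LiuD3KudlaOfLineRigidity.lean) and `HypD3.isoOfParams_of_lineRigidity` (B-p09 F9b p605777, A4LiuD3IsoOfParamsOfLineRigidity.lean), ∀-closed, byte-identical); `stub_kudlaTransportedSectionEq` is PROVED place-free (`HypD3.kudla_of_lineRigidity … (stub_lineRigidityS6a …)`, no `by_cases`) and :203 `stub_iso_of_params := HypD3.isoOfParams_of_lineRigidityS6a stub_lineRigidityS6a` is CLOSED BY NAME.  REGISTERED OPEN STUBS (3): `stub_lineRigidityS6a` (S6a;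 B-p13 F8b-3 MAIN + B-p02 F8a + B-p14 wrapper `CorCM/HypD3/A4LiuD3LineRigidityOfF8.lean`), `stub_rankOne_theta_lines_disjoint` (c1, A-p15/B-p01/B-p10 P-pieces), `stub_rankOne_theta_twist_rigidity` (c3, route R: B-p03/B-p18).  Zero mathematical content added or removed.  HC_CM is proved only modulo the 7 printed citations until rung 0 closes.  **v5 (A-plan2, 2026-08-28T05:14:44Z; director g2 05:04:01Z ∕ 05:07:01Z «a4_liuD3 v5 sorries 2 = S6a + c3 on ACCEPT»): c1 CLOSED BY NAME** — row IV-4(c1) DISCHARGED by B-p10 ★ p606332 `MoeglinVignerasWaldspurger1987/RankOneThetaLiftLinesDisjointHolds.lean` (`rankOne_theta_lines_disjoint_holds`, over B-p17 P3-concrete p606171 + B-p01 P4 generic p605821/p605925 + B-p10 P2 p605462 + A-p15's hP34 interface): `stub_rankOne_theta_lines_disjoint := rankOne_theta_lines_disjoint_holds`.  REGISTERED OPEN STUBS (2): `stub_lineRigidityS6a` (S6a; B-p13 F8b-3 MAIN → B-p14 `HypD3.lineRigidityTransported_of_perCharacter` p605922 wrapper), `stub_rankOne_theta_twist_rigidity`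 (c3; route R wrapper B-p18 p606210 over B-p03).  HC_CM is proved only modulo the 7 printed citations until rung 0 closes.  **v6 (A-plan2, 2026-08-28T05:26:58Z; director g2 05:19:46Z «hD3 sorries 1 = c3 WALL»): S6a CLOSED BY NAME** — `stub_lineRigidityS6a := HypD3.lineRigidityS6a` (B-p14 ★ p606846 `CorCM/HypD3/A4LiuD3LineRigidityS6a.lean`, hypothesis-free, `:= lineRigidityTransported_of_perCharacter` p605922 fed with B-p13's ★ F8b-3 MAIN p606519 `GelbartRogawski1991/LocalLineIsometryNaturality.lean` + B-p02 F8a; statement == `def LineRigidityS6a` as an Expr).  REGISTERED OPEN STUB (1): `stub_rankOne_theta_twist_rigidity` (c3 = row IV-4(c3), `MoeglinVignerasWaldspurger1987.rankOne_theta_twist_rigidity`; route R: B-p18 wrapper p606210 `rankOne_theta_twist_rigidity_of_nonPeriodic₁₁` over B-p03's `twistRigid_of_congr` / `twistRigid_of_nonPeriodic₁₁_block` / R1d-i p605449 — the WALL).  hD3 = c3 exactly.  HC_CM is proved only modulo the 7 printed citations until rung 0 closes.  **v7 (A-plan2 g2, 2026-08-28T07:47:00Z; director g2 BATCH 61 (a)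 «a4_liuD3 v7 = c3 stub closed BY NAME the minute the leaf lands; sorries 0»): c3 CLOSED BY NAME** — `stub_rankOne_theta_twist_rigidity := Literature.RepresentationTheory.MoeglinVignerasWaldspurger1987.rankOne_theta_twist_rigidity_holds` (B-p18 ★ p613492 `Literature/RepresentationTheory/MoeglinVignerasWaldspurger1987/RankOneThetaLiftTwistRigidityHolds.lean`; over the WALL `nonPeriodic₁₁_holds` := `nonPeriodic₁₁_of_torusTrace` ∘ `rankOne_torusTrace_ne_zero_of_bigCellPackage` ∘ H1 `rankOne_torus_bigCell_package` B-p17 p612837; TR record B-p04 p613287).  REGISTERED OPEN STUBS (0): the skeleton is `sorry`-free — every binder of `HD3_proof` is discharged BY NAME (S6a `HypD3.lineRigidityS6a`, c1 `rankOne_theta_lines_disjoint_holds`, c3 `rankOne_theta_twist_rigidity_holds`, c4 `rankOne_theta_twist_rigidity_split_holds`); the ITEM stmt-HodgeConjecture-24837 is CLOSED — proved (gate type-match 07:45:28Z) by A-p13's `Summit.HodgeConjecture.HodgeConjecture.Theorems.HD3_proof := HD3_of_bigCellPackage rankOne_torus_bigCell_package` (`Theorems/HCCMUnconditionalHD3.lean`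 §2, p613567; H1 = B-p17 p612837; `HD3_of_torusTrace` p611200 ∕ `HD3_of_bigCellPackage` p611574) — this skeleton's head `HD3_proof` has the same type and is now a second, line-shaped sorry-free proof of the item (not imported here, so the workfile does not serialize behind that olean).  Every `theorem` statement token-identical to v6; zero mathematical content added or removed.  HC_CM is proved only modulo the 7 printed citations until rung 0 closes.

# `Lines/a4-liuD3.lean` — crux skeleton for the binder `hD3` = `PrintedCitationHypotheses.HypD3`
# ([Liu 2021, App. D Lem. D.1 (3)] AS PRINTED, per finite place `v` of `F⁺`, `n = 3`, on the χ-split face family)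

Cell `hodgecm-mathlib`, fan A, rung A-IV (planner seat A-plan2; BODY in family currency by B-plan1, `B-plan/lines/a4-liuD3-draft.lean`
sha16 48f2aa5871f7ed60, director ACK 02:24:38Z; HEAD, the place split and the closed-Prop registration by A-plan2).  TARGET BY NAME = the decl of record
`Summit.HodgeConjecture.CorCM.D2Bridge.MuKeyIdentLemD3DelRecConjOmegaEndT.PrintedCitationHypotheses.HypD3` (`PrintedCitationHypothesesT.lean` :101–:106)
= `∀ hDel, <binder hD3 of the headline hc_cm_of_printed_citations_muKey_ident_lemD3_delRecConjOmegaT, verbatim>`, restated character-identically as the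
local `HypD3` (switch to the import when the farm snapshot builds the pack).
**HC_CM is proved only modulo the 7 printed citations (`hDel`, `h21`, `hLiu418`, `h411`, `h413`, `hD3`, `hD1''`) until rung 0 closes; this file removes
none of them — it cuts `hD3` into named stubs.**

## The datum, unfolded
`HypD3` says: for every face prefix `(F, h6, ι₁, V, a, Φ ∋ ι₁)` and EVERY finite place `v` of `F⁺` (split in `F` or not — there is no `IsField (F ⊗ F⁺_v)`
guard), [Lem. D.1 (3)] AS PRINTED (`LemD1_3AsPrintedI`, `LemD1AsPrintedIndexed.lean` :174: `3 ≤ n → ∀ i j, Θ_j ≅ Θ_i ↔ (μ_{j,v} = μ_{i,v} ∧ ε_i ~ ε_j ∧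
χ_{j,v} = χ_{i,v})`) holds for the INDEXED LOCAL FAMILY `Def411WeilCarriers.localIndexedFamilyAtV … v` (`Def411WeilCarriersLocalDataAtV.lean` :353) of the
face: index `t = (μw, j) : Σ (μ conj.-symplectic of weight one) × AdmIndex D(μ)`, `N = n = 3`, ONE trace-zero `δ := imagUnit F`, frame `J_V = diagonal
(frameD V)`, member `t ↦ (a_t := r_a(ε_j) ∈ F⁺ˣ, χ_t := χ_j, 𝓢_t := THE χ-splitting OmegaChiSplitting.chiLocalSplittingsD … (toHeckeCharacter μ) … a_t,
μ_{t,v} := localMu F (toHeckeCharacter μ) v)`.  B-plan1's `famAtV` (§1, verbatim) is this instantiation made GENERIC in the frame `dV` and the index maps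
`(ψ, hψ, aOf, χOf)`; the head `HypD3_of` (§2) is instantiation at `dV := frameD V`, `ψ t := t.1.1`, `aOf t := r_a(t.2.1.1)`, `χOf t := t.2.1.2` — `exact`.

## WHY THIS LINE
The binder is the per-place (3) and nothing more, and its two directions have different owners in print, so the cut is forced: «⇒» = SEPARATION of
rank-one theta lifts (non-split `v`: lines-disjointness IV-4c1 [GR90 Prop. 5.1.4 / SZ15 conservation] + centre-character rigidity IV-4c2 (PROVED p593978)
+ twist rigidity IV-4c3 [MVW87 3.IV.4; Howe duality], all three already in the tree over ONE model `LocalMp F 3 T v` with VARYING `δ`, packaged in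
δ-currency by B-p13's PROVED `rankOne_theta_sameClass_and_char_eq_of_areIsomorphicRep` (p596487); split `v`: type II Howe duality for `(GL₁, GL₃)`
[Mínguez 2008 Thm 1] = the NEW named fact IV-4c4 per director RULING q4 02:20:53Z — `HypD3` quantifies over all `v` and `NonIso` (p593829) consumes (3)
AT split places, so the split third is load-bearing, not droppable), «⇐» = ISOMETRY TRANSPORT along `ε′ = x x̄ ε` (IV-4(b), PROVED shape in
`LemD1DataOfPlaceIsometric` / `IndexedCarrierTransport`) + equality of the χ-splitting sections for equal local `μ`.  The one internal step common to
all closers is the MODEL TRANSPORT `e′_a : (x, y) ↦ (x, a•y)` from member `t`'s model `LocalMp F 3 (a_t • T_V) v` (δ fixed) to the rows' model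
`LocalMp F 3 T_V v` (δ′ := δ/a_t) — B-p13's next PROVED file (director 02:22:42Z); it is quoted BY NAME inside the closers and is deliberately NOT a stub
(its statement is the prover's to fix; a stub would freeze the wrong currency — B-p13 CURRENCY GAP note 02:09:08Z).
The head splits `by_cases hE : IsField (UnitaryGroup.LocalRing F v)` (A-plan2 q4 02:17:19Z, director 02:20:53Z/02:24:38Z): the three non-split rows
carry `(hE : IsField …)` (RankOneThetaLiftLinesDisjoint.lean :82), the split row carries `¬ IsField`, and the ε-clause at split `v` is a separate
PROVABLE stub (one `Nm(E_vˣ)`-class when `E_v = F_v × F_v`).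

## Stub inventory (5 registered stubs; INVENTORY §8.2 rows IV-4(b), IV-4c1–c4)
| stub | third of (3) | places | closes from | fan · size |
|---|---|---|---|---|
| `stub_sameClass_and_chi_of_iso_nonsplit` | ⇒ ε-class ∧ χ | non-split | IV-4c1 `rankOne_theta_lines_disjoint` (NAMED FACT p595679) + IV-4c2 (PROVED p593978) via B-p13 p596487 + model transport | B · L |
| `stub_mu_of_iso_nonsplit` | ⇒ μ | non-split | IV-4c3 `rankOne_theta_twist_rigidity` (NAMED FACT p595399; debt-neutral pieces M1–M3 B-p05/B-p03, M4 cuspidal = WALL) + «χ-splitting determines μ locally» + transport | B · L |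
| `stub_splitInjective` | ⇒ μ ∧ χ | split | IV-4c4 (NEW NAMED FACT, ruling q4: `(GL₁,GL₃)` type II Howe duality [Mínguez 2008 Thm 1 / Cor 6.3] + uniqueness of Langlands data [BZ77 2.9]) + transport | B · L |
| `stub_sameClass_of_split` | ⇒ ε-class | split | PROVABLE: `E ⊗ F⁺_v ≅ F⁺_v × F⁺_v` with `c` the swap ⇒ every `u ∈ F⁺_vˣ` is `x·c(x)`, `x = (u,1)`; `ε_j/ε_i = a_j/a_i ∈ F⁺_vˣ` | A · M |
| `stub_iso_of_params` | ⇐ | all | IV-4(b) isometry transport `weilRep_iso_of_isometry` shape (`LemD1DataOfPlaceIsometric`, `IndexedCarrierTransport`) + equal sections for equal `μ_v` | B · M–L |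
-/

set_option autoImplicit false

noncomputable section

namespace Summit.HodgeConjecture.CorCM.Lines.A4LiuD3
open scoped TensorProduct Matrix
open NumberField NumberField.InfinitePlace
open HodgeCM.Model HodgeCM.Model.LiuIndex HodgeCM.Model.TowerCarrier
open HodgeCM.Literature.Theta.LiuAlbaneseModuleDatum.D2Bridge (HcmPieces)
open Summit.HodgeConjecture.CorCM.Model
open Literature.AlgebraicGeometry.Motives (CMType)
open Literature.AlgebraicGeometry.HodgeTheory Literature.NumberTheory.Automorphic.PicardCM
open Literature.AlgebraicGeometry.ShimuraVarieties.UnitaryCanonicalModel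
open Literature.NumberTheory.ComplexMultiplication
open Literature.NumberTheory.Automorphic
open Literature.NumberTheory.Automorphic.IdeleClassGroup (toHeckeCharacter isUnitary_toHeckeCharacter galConj)
open Literature.NumberTheory.Automorphic.Liu2021 Literature.NumberTheory.Automorphic.Liu2021.AppendixC
open Literature.NumberTheory.Automorphic.Liu2021.AppendixC.RestOne
open Literature.NumberTheory.Automorphic.Liu2021.Def411WeilCarriers (lineOf locF Rep)
open Summit.HodgeConjecture.CorCM.Transposition.OmegaTransport (realUnit)
open HodgeCM.Model.ArchSideTerm (e₁)
open Literature.NumberTheory.GelbartRogawski1991 Literature.NumberTheory.GelbartRogawski1991.UnitaryDualPair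
open Literature.NumberTheory.GelbartRogawski1991.UnitaryDualPair.LocalSplitting (localMu norm_localMu continuous_localMu localMu_toLocalRing_eq_one_iff
  eq_of_forall_localMu_toHeckeCharacter_eq)
open Literature.RepresentationTheory Literature.RepresentationTheory.Liu2021
open Summit.HodgeConjecture.CorCM.Transposition
open Literature.RepresentationTheory.MoeglinVignerasWaldspurger1987 (rankOne_theta_lines_disjoint rankOne_theta_twist_rigidity rankOne_theta_twist_rigidity_split
  lineTransportSplitting)
open Literature.NumberTheory.GelbartRogawski1991.UnitaryDualPair.LocalSplitting (lineTransportSection conj_lineDelta lineDelta_ne_zero lineDelta_mul_self)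
open Summit.HodgeConjecture.CorCM.D2Bridge.AdapterMuConj (muConj prop413AsPrinted_muConj def411_muConj nontrivial_omegaAt_muConj_rest)
open Summit.HodgeConjecture.CorCM.D2Bridge.MuKeyIdentEnd (hc_cm_of_printed_citations_muKey_ident)
open Summit.HodgeConjecture.CorCM.D2Bridge.MuKeyIdentLemD3End
open Summit.HodgeConjecture.CorCM.D2Bridge.MuKeyIdentLemD3DelRecConjOmegaEnd (diagonal_frameD_map_complexConj)
open Summit.HodgeConjecture.CorCM.D2Bridge.MuKeyIdentLemD3DelRecConjOmegaEndT (hc_cm_of_printed_citations_muKey_ident_lemD3_delRecConjOmegaT)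
open MeasureTheory

/-! ## §1 The family of record `famAtV` and the five STUB TYPES at `e₁` with their (D1) fact binders are the TREE decls of
`Summits/HodgeConjecture/CorCM/HypD3/A4LiuD3Items.lean` (A-p05; namespace `Summit.HodgeConjecture.CorCM.Lines.A4LiuD3`, imported above): `famAtV`, `SameClassChiOfIsoNonsplit`,
`MuOfIsoNonsplit`, `SplitInjective`, `SameClassOfSplit`, `IsoOfParams` — v1 :94–:182 with `e ↦ e₁` and the leading fact binders, nothing else. -/

/-! ## §2 The stubs (slots :185 :190 :195 :199 :203 CLOSED BY NAME; the place-free residual `stub_lineRigidityS6a` CLOSED BY NAME in v6) and the RESIDUAL FACT STUBS (row IV-4c3 CLOSED BY NAME in v7; IV-4c1 (v5) and IV-4c4 CLOSED BY NAME — 0 `sorry`) -/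

/-- **v2: CLOSED BY NAME** (A-p05 p602107 `HypD3.sameClassChiOfIsoNonsplit (h41 : rankOne_theta_lines_disjoint)`). `stub_sameClass_and_chi_of_iso_nonsplit` — registered stub (fan B, L; closers: B-p13 transport + p596487 by name). [cite: Liu2021, App. D Lem. D.1 (3)] -/
theorem stub_sameClass_and_chi_of_iso_nonsplit : SameClassChiOfIsoNonsplit :=
  Summit.HodgeConjecture.CorCM.HypD3.sameClassChiOfIsoNonsplit   -- CLOSED BY NAME (A-p05 p602107)

-- heartbeats: elaborating the spelled `hK` text alone exceeds the default budget (B-p18 p602388 / B-p14 p603508 use the same option on their statements).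
set_option maxHeartbeats 1600000 in
/-- **`KudlaTransportedSectionEq` — the common hypothesis `∀ i j, hK i j` of the «⇒» closers (v2 text; since v4 PROVED place-free from the ONE residual `stub_lineRigidityS6a` via `HypD3.kudla_of_lineRigidity`)**: Kudla's local splitting uniqueness in TRANSPORTED
form — for all members `i, j` of the family of record at `e₁`: if the model-transported χ-splitting sections of members `i` and `j` agree at SOME unit `x` of
`F ⊗ F⁺_v` relating the two line discriminants (`a_j⁻¹ δ = x x̄ a_i⁻¹ δ`), then the local components `μ_{j,v} = μ_{i,v}`.  TEXT = the hypothesis `hK i j` of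
B-p18's `HypD3.splitInjective_of_facts` (p602388) and of B-p14's `HypD3.muOfIsoNonsplit_of_facts` (p603508), BYTE-IDENTICAL in both (python-checked), universally
closed over the family binders.  CLOSERS (announced): S6a B-p13 F6–F8 (`LocalKudlaSplittingUniqueness`), S6b B-p14 p602118 `localMu_eq_of_localSplittingCM_eq`
(LANDED), S6c p600767 — «ONE discharge `∀ i j, hK i j` closes :190 AND :195's (K) simultaneously» (B-p14 03:50:44Z).  Why it might fail: only if the transported
section `lineTransportSplitting … x …` is not literally the CM splitting of the common model (normalisation by the character of `x`), in which case S6a restates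
`hK` with the twist made explicit and this def is re-typed (kill path: re-type, not retire). [cite: Kudla1994, Thm. 3.1 / splitting uniqueness] [cite: Liu2021, App. D Lem. D.1 (3), proof l. 5255] [cite: HarrisKudlaSweet1996, §1] -/
def KudlaTransportedSectionEq : Prop :=
  ∀ (F : HodgeCM.CMField) (dV : Fin 3 → (F : Type))
      (hdV : ∀ i, IsCMField.complexConj (F : Type) (dV i) = dV i) (hdV0 : ∀ i, dV i ≠ 0) {ι : Type}
      (ψ : ι → (Literature.NumberTheory.Automorphic.IdeleClassGroup (F : Type) →ₜ* Circle))
      (hψ : ∀ t, IdeleClassGroup.IsConjugateSymplectic (F : Type) (ψ t))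
      (aOf : ι → (↥(maximalRealSubfield (F : Type)))ˣ)
      (χOf : ι → Def411WeilCarriers.Chi ↥(maximalRealSubfield (F : Type)) (F : Type) (IsCMField.complexConj (F : Type)))
      (v : IsDedekindDomain.HeightOneSpectrum (𝓞 ↥(maximalRealSubfield (F : Type)))),
      ∀ i j : ι,
        (∃ (x : (UnitaryGroup.LocalRing (F : Type) v)ˣ) (hx : algebraMap (F : Type) (UnitaryGroup.LocalRing (F : Type) v) (algebraMap ↥(maximalRealSubfield (F : Type)) (F : Type) (↑(aOf j)⁻¹ : ↥(maximalRealSubfield (F : Type))) * imagUnit (F : Type)) =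
            (x : (UnitaryGroup.LocalRing (F : Type) v)) * UnitaryGroup.conjLocal (F : Type) (IsCMField.complexConj (F : Type)) v x * algebraMap (F : Type) (UnitaryGroup.LocalRing (F : Type) v) (algebraMap ↥(maximalRealSubfield (F : Type)) (F : Type) (↑(aOf i)⁻¹ : ↥(maximalRealSubfield (F : Type))) * imagUnit (F : Type))),
          lineTransportSplitting (F : Type) v (IsCMField.complexConj (F : Type)) 3 (conj_lineDelta (complexConj_imagUnit (F : Type)) (aOf i)) (lineDelta_ne_zero (imagUnit_ne_zero (F : Type)) (aOf i))
            (lineDelta_mul_self (imagUnit_mul_self (F : Type)) (aOf i)) (conj_lineDelta (complexConj_imagUnit (F : Type)) (aOf j)) (lineDelta_ne_zero (imagUnit_ne_zero (F : Type)) (aOf j))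
            (lineDelta_mul_self (imagUnit_mul_self (F : Type)) (aOf j)) x (realDiagonal (F : Type) dV hdV) (realDiagonal_isSymm (F : Type) dV hdV) (isUnit_det_realDiagonal (F : Type) dV hdV hdV0) hx
            (lineTransportSection ↥(maximalRealSubfield (F : Type)) (F : Type) (IsCMField.complexConj (F : Type)) 3 (complexConj_imagUnit (F : Type)) (imagUnit_ne_zero (F : Type)) (imagUnit_mul_self (F : Type)) (realDiagonal (F : Type) dV hdV) (realDiagonal_isSymm (F : Type) dV hdV) (Matrix.diagonal dV) (realDiagonal_map (F : Type) dV hdV).symm (aOf i) v ((OmegaChiSplitting.chiLocalSplittingsD ⟨HodgeCM.CMField.K F⟩ e₁ dV hdV hdV0 (toHeckeCharacter (F : Type) (ψ i)) ((isOscillatorChar_toHeckeCharacter_iff (ψ i)).mpr (hψ i)) (aOf i)).s v) ((OmegaChiSplitting.chiLocalSplittingsD ⟨HodgeCM.CMField.K F⟩ e₁ dV hdV hdV0 (toHeckeCharacter (F : Type) (ψ i)) ((isOscillatorChar_toHeckeCharacter_iff (ψ i)).mpr (hψ i)) (aOf i)).proj_s v)) =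
          (lineTransportSection ↥(maximalRealSubfield (F : Type)) (F : Type) (IsCMField.complexConj (F : Type)) 3 (complexConj_imagUnit (F : Type)) (imagUnit_ne_zero (F : Type)) (imagUnit_mul_self (F : Type)) (realDiagonal (F : Type) dV hdV) (realDiagonal_isSymm (F : Type) dV hdV) (Matrix.diagonal dV) (realDiagonal_map (F : Type) dV hdV).symm (aOf j) v ((OmegaChiSplitting.chiLocalSplittingsD ⟨HodgeCM.CMField.K F⟩ e₁ dV hdV hdV0 (toHeckeCharacter (F : Type) (ψ j)) ((isOscillatorChar_toHeckeCharacter_iff (ψ j)).mpr (hψ j)) (aOf j)).s v) ((OmegaChiSplitting.chiLocalSplittingsD ⟨HodgeCM.CMField.K F⟩ e₁ dV hdV hdV0 (toHeckeCharacter (F : Type) (ψ j)) ((isOscillatorChar_toHeckeCharacter_iff (ψ j)).mpr (hψ j)) (aOf j)).proj_s v))) →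
        localMu (F : Type) (toHeckeCharacter (F : Type) (ψ j)) v = localMu (F : Type) (toHeckeCharacter (F : Type) (ψ i)) v

set_option maxHeartbeats 1600000 in
/-- **`LineRigidityS6a` (v4 registered residual, ALL finite places) = B-p13's S6a «line-rigidity identity», PLACE-FREE, in the EXACT shape consumed by the tree theorems
`HypD3.kudla_of_lineRigidity` (B-p18 p605088, A4LiuD3KudlaOfLineRigidity.lean, hypothesis `hS6a`) and `HypD3.isoOfParams_of_lineRigidity` (B-p09 F9b p605777), ∀-closed and
BYTE-IDENTICAL to both (= v3's `LineRigidityS6aNonsplit` with the `IsField (F ⊗ F⁺_v) →` line deleted; B-p14's `LineRigidityTransported`)**: at every finite place `v` of `F⁺`, for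
members `i, j` and every unit `x` of `F ⊗ F⁺_v` relating the line discriminants `δ/a_j = x x̄ δ/a_i`, the line transport by `x` of member `i`'s `χ`-attached section on the line `a_i`
IS member `i`'s character's `χ`-attached section on the line `a_j`.  Given it, `hK i j` (`KudlaTransportedSectionEq`) follows at every place in five lines (tree, `lineTransportSection_injective`
+ B-p14's `localMu_eq_of_congrW_undoubledSplittings_s_eq_three`) and :203 `IsoOfParams` follows by F9a/F9b.  OWNER of the closer: B-p13 (F6 `LocalKudlaSplittingRigidity` p603084, F8b-3 MAIN
`GelbartRogawski1991/LocalLineIsometryNaturality.lean`) + B-p02 F8a (undoubling / line-isometry commutation) + B-p14 (Summits wrapper `CorCM/HypD3/A4LiuD3LineRigidityOfF8.lean` proving this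
text by name, director g2 DEDUP 04:44:13Z).  Why it might fail: the two sections are P_Δ-normalised homomorphic sections of the doubled cover with the same projection — they coincide iff the
normalisations match, which is what F7/F8 verify; a mismatch by a character of `x` would force re-typing with the twist explicit (kill path: re-type, not retire).
[cite: Kudla1994, §3 Thm. 3.1] [cite: HarrisKudlaSweet1996, §1] [cite: MoeglinVignerasWaldspurger1987, Chap. 3 IV.4] [cite: Liu2021, App. D Lem. D.1 (3), proof l. 5249–5255] -/
def LineRigidityS6a : Prop :=
  ∀ (F : HodgeCM.CMField) (dV : Fin 3 → (F : Type))
      (hdV : ∀ i, IsCMField.complexConj (F : Type) (dV i) = dV i) (hdV0 : ∀ i, dV i ≠ 0) {ι : Type}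
      (ψ : ι → (Literature.NumberTheory.Automorphic.IdeleClassGroup (F : Type) →ₜ* Circle))
      (hψ : ∀ t, IdeleClassGroup.IsConjugateSymplectic (F : Type) (ψ t))
      (aOf : ι → (↥(maximalRealSubfield (F : Type)))ˣ)
      (v : IsDedekindDomain.HeightOneSpectrum (𝓞 ↥(maximalRealSubfield (F : Type)))),
      ∀ i j : ι,
        ∀ (x : (UnitaryGroup.LocalRing (F : Type) v)ˣ) (hx : algebraMap (F : Type) (UnitaryGroup.LocalRing (F : Type) v) (algebraMap ↥(maximalRealSubfield (F : Type)) (F : Type) (↑(aOf j)⁻¹ : ↥(maximalRealSubfield (F : Type))) * imagUnit (F : Type)) =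
            (x : (UnitaryGroup.LocalRing (F : Type) v)) * UnitaryGroup.conjLocal (F : Type) (IsCMField.complexConj (F : Type)) v x * algebraMap (F : Type) (UnitaryGroup.LocalRing (F : Type) v) (algebraMap ↥(maximalRealSubfield (F : Type)) (F : Type) (↑(aOf i)⁻¹ : ↥(maximalRealSubfield (F : Type))) * imagUnit (F : Type))),
          lineTransportSplitting (F : Type) v (IsCMField.complexConj (F : Type)) 3 (conj_lineDelta (complexConj_imagUnit (F : Type)) (aOf i)) (lineDelta_ne_zero (imagUnit_ne_zero (F : Type)) (aOf i))
            (lineDelta_mul_self (imagUnit_mul_self (F : Type)) (aOf i)) (conj_lineDelta (complexConj_imagUnit (F : Type)) (aOf j)) (lineDelta_ne_zero (imagUnit_ne_zero (F : Type)) (aOf j))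
            (lineDelta_mul_self (imagUnit_mul_self (F : Type)) (aOf j)) x (realDiagonal (F : Type) dV hdV) (realDiagonal_isSymm (F : Type) dV hdV) (isUnit_det_realDiagonal (F : Type) dV hdV hdV0) hx
            (lineTransportSection ↥(maximalRealSubfield (F : Type)) (F : Type) (IsCMField.complexConj (F : Type)) 3 (complexConj_imagUnit (F : Type)) (imagUnit_ne_zero (F : Type)) (imagUnit_mul_self (F : Type)) (realDiagonal (F : Type) dV hdV) (realDiagonal_isSymm (F : Type) dV hdV) (Matrix.diagonal dV) (realDiagonal_map (F : Type) dV hdV).symm (aOf i) v ((OmegaChiSplitting.chiLocalSplittingsD ⟨HodgeCM.CMField.K F⟩ e₁ dV hdV hdV0 (toHeckeCharacter (F : Type) (ψ i)) ((isOscillatorChar_toHeckeCharacter_iff (ψ i)).mpr (hψ i)) (aOf i)).s v) ((OmegaChiSplitting.chiLocalSplittingsD ⟨HodgeCM.CMField.K F⟩ e₁ dV hdV hdV0 (toHeckeCharacter (F : Type) (ψ i)) ((isOscillatorChar_toHeckeCharacter_iff (ψ i)).mpr (hψ i)) (aOf i)).proj_s v)) =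
          (lineTransportSection ↥(maximalRealSubfield (F : Type)) (F : Type) (IsCMField.complexConj (F : Type)) 3 (complexConj_imagUnit (F : Type)) (imagUnit_ne_zero (F : Type)) (imagUnit_mul_self (F : Type)) (realDiagonal (F : Type) dV hdV) (realDiagonal_isSymm (F : Type) dV hdV) (Matrix.diagonal dV) (realDiagonal_map (F : Type) dV hdV).symm (aOf j) v ((OmegaChiSplitting.chiLocalSplittingsD ⟨HodgeCM.CMField.K F⟩ e₁ dV hdV hdV0 (toHeckeCharacter (F : Type) (ψ i)) ((isOscillatorChar_toHeckeCharacter_iff (ψ i)).mpr (hψ i)) (aOf j)).s v) ((OmegaChiSplitting.chiLocalSplittingsD ⟨HodgeCM.CMField.K F⟩ e₁ dV hdV hdV0 (toHeckeCharacter (F : Type) (ψ i)) ((isOscillatorChar_toHeckeCharacter_iff (ψ i)).mpr (hψ i)) (aOf j)).proj_s v))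

set_option maxHeartbeats 1600000 in
/-- `stub_lineRigidityS6a` — **THE registered RESIDUAL stub of `hD3` besides the fact rows c1/c3 (v4; fan B, M–L)**: S6a at all finite places (B-p13 F8b-3 + B-p02 F8a, wrapped by B-p14);
**v6: CLOSED BY NAME** `:= HypD3.lineRigidityS6a` (B-p14 p606846, hypothesis-free, over B-p13 F8b-3 MAIN p606519 + B-p02 F8a + B-p14 p605922). [cite: Kudla1994, §3] [cite: MoeglinVignerasWaldspurger1987, Chap. 3 IV.4] [cite: Liu2021, App. D Lem. D.1 (3)] -/
theorem stub_lineRigidityS6a : LineRigidityS6a :=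
  Summit.HodgeConjecture.CorCM.HypD3.lineRigidityS6a   -- v6: CLOSED BY NAME (B-p14 p606846 / B-p13 p606519)

set_option maxHeartbeats 4000000 in
/-- **v4: the uniform `hK` block PROVED place-free modulo `stub_lineRigidityS6a`** — the tree theorem `HypD3.kudla_of_lineRigidity` (B-p18 p605088; B-p14's closure test
`B-provers/B-p14/ClosureTest-KudlaTransportedSectionEq-of-LineRigidity.lean` b9bbb9d2dbe37933 is the same term) fed with the residual; no `by_cases` on the place type (v3's split is gone).
[cite: Kudla1994, §3 Thm. 3.1] [cite: Liu2021, App. D Lem. D.1 (3), proof l. 5255] -/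
theorem stub_kudlaTransportedSectionEq : KudlaTransportedSectionEq := by
  intro F dV hdV hdV0 ι ψ hψ aOf χOf v i j
  exact Summit.HodgeConjecture.CorCM.HypD3.kudla_of_lineRigidity F dV hdV hdV0 ψ hψ aOf v i j
    (stub_lineRigidityS6a F dV hdV hdV0 ψ hψ aOf v i j)

set_option maxHeartbeats 4000000 in
/-- **v2: CLOSED BY NAME modulo `stub_kudlaTransportedSectionEq`** (B-p14 p603508 `HypD3.muOfIsoNonsplit_of_facts (h41) (h43) : ∀ F dV …, (∀ i j, hK i j) → IsField … → …`).
`stub_mu_of_iso_nonsplit` — registered statement (fan B, L; IV-4c1/IV-4c3 by name through the transport; M4 cuspidal half of IV-4c3 = WALL booked for the successor,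
director 02:28:38Z). [cite: Liu2021, App. D Lem. D.1 (3)] [cite: MoeglinVignerasWaldspurger1987, Chap. 3 IV.4] -/
theorem stub_mu_of_iso_nonsplit : MuOfIsoNonsplit := by
  intro h41 h43 F dV hdV hdV0 ι ψ hψ aOf χOf v
  -- v2: CLOSED BY NAME modulo `stub_kudlaTransportedSectionEq` (B-p14 p603508)
  exact Summit.HodgeConjecture.CorCM.HypD3.muOfIsoNonsplit_of_facts h41 h43 F dV hdV hdV0 ψ hψ aOf χOf v
    (stub_kudlaTransportedSectionEq F dV hdV hdV0 ψ hψ aOf χOf v)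

set_option maxHeartbeats 4000000 in
/-- **v2: CLOSED BY NAME modulo `stub_kudlaTransportedSectionEq`** (B-p18 p602388 `HypD3.splitInjective_of_facts (h4) (hIV3a) (hIV3b)`, fed with the PROVED IV-3(a)
`Liu2021.splitPlace_chiCoinv_iso_parabolicIndGL_holds` (B-p08, SplitPlaceOscillatorModelUniform.lean) and IV-3(b) `Zelevinsky1980.parabolicIndGL_detChar_unitary_isIrreducible_holds`
(B-p09 p601139)).  `stub_splitInjective` — registered statement (fan B, L; IV-4c4 by name through the transport). [cite: Minguez2008, Thm. 1] [cite: Liu2021, App. D Lem. D.1 (3)] -/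
theorem stub_splitInjective : SplitInjective := by
  intro h4 F dV hdV hdV0 ι ψ hψ aOf χOf v
  -- v2: CLOSED BY NAME modulo `stub_kudlaTransportedSectionEq` (B-p18 p602388; IV-3a/IV-3b `_holds` B-p08/B-p09)
  exact Summit.HodgeConjecture.CorCM.HypD3.splitInjective_of_facts h4
    Literature.NumberTheory.Automorphic.Liu2021.splitPlace_chiCoinv_iso_parabolicIndGL_holds
    Literature.NumberTheory.Automorphic.Zelevinsky1980.parabolicIndGL_detChar_unitary_isIrreducible_holds.{0}
    F dV hdV hdV0 ψ hψ aOf χOf v (stub_kudlaTransportedSectionEq F dV hdV hdV0 ψ hψ aOf χOf v)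

/-- **v2: CLOSED BY NAME** (B-p18 p600298 `HypD3.sameClassOfSplit`, ∀ e, at e₁). `stub_sameClass_of_split` — registered stub (fan A, M; PROVABLE split-place norm surjectivity). [cite: Liu2021, App. D Lem. D.1 (3), proof l. 5253] -/
theorem stub_sameClass_of_split : SameClassOfSplit :=
  fun F => Summit.HodgeConjecture.CorCM.HypD3.sameClassOfSplit F e₁   -- CLOSED BY NAME (B-p18 p600298, general `e`, specialised at e₁)

set_option maxHeartbeats 1600000 in
/-- **v4: `stub_iso_of_params` (:203) CLOSED BY NAME modulo `stub_lineRigidityS6a`** — B-p09 F9a p605627 (`Liu2021/LemD1Item3AtVIsoOfLineTransport.lean`: class witness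
`exists_lineDelta_witness_of_sameClass_eps`, locality of the `χ`-splitting section in `μ_v`, `areIsomorphicRep_quot_of_lineTransportSplitting_eq_prodUnique`) + F9b p605777
(`HypD3.isoOfParams_of_lineRigidityS6a (hS6a : <this file's LineRigidityS6a text>) : IsoOfParams`, the registered type by name). [cite: Liu2021, App. D Lem. D.1 (3) (l. 5233)]
[cite: MoeglinVignerasWaldspurger1987, Chap. 2 II.1, Chap. 3 I.1–I.3, IV.4] [cite: Kudla1994, §3 Thm. 3.1] -/
theorem stub_iso_of_params : IsoOfParams :=
  Summit.HodgeConjecture.CorCM.HypD3.isoOfParams_of_lineRigidityS6a stub_lineRigidityS6a   -- CLOSED BY NAME (B-p09 F9b p605777) modulo S6a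

/-- **stub (RESIDUAL FACT, row IV-4(c1)) — disjointness of the rank-one theta lines** [MVW87, Ch. 3 IV.4; Liu21 App. D l. 5255] (named fact
`Literature.RepresentationTheory.MoeglinVignerasWaldspurger1987.rankOne_theta_lines_disjoint`, RankOneThetaLiftLinesDisjoint.lean :75, p595679; owner A-p15, KEY
ec1053cf4b0ba556).  Consumed by `SameClassChiOfIsoNonsplit` / `MuOfIsoNonsplit` as their leading binder.  Why it might fail: as a CITE it cannot; the proof is the
see-saw / doubling-density separation of the lines (B-p02 R6″ E-nodes) — L.
**v5: CLOSED BY NAME** `:= rankOne_theta_lines_disjoint_holds` (B-p10 p606332 `RankOneThetaLiftLinesDisjointHolds.lean`: doubled-root nilpotent form of the two lines,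
B-p17 P3-concrete p606171 + B-p01 P4 generic `SkewNilpotentConjugation` p605821/p605925 + B-p10 P2 p605462, A-p15's hP34 interface filled).
[cite: MoeglinVignerasWaldspurger1987, Ch. 3 IV.4] [cite: Liu2021, App. D Lem. D.1 (3), proof l. 5255] -/
theorem stub_rankOne_theta_lines_disjoint : Literature.RepresentationTheory.MoeglinVignerasWaldspurger1987.rankOne_theta_lines_disjoint :=
  Literature.RepresentationTheory.MoeglinVignerasWaldspurger1987.rankOne_theta_lines_disjoint_holds   -- v5: CLOSED BY NAME (B-p10 p606332)

/-- **stub (RESIDUAL FACT, row IV-4(c3)) — twist rigidity of the rank-one theta lift at a non-split place** [MVW87, Ch. 3 IV.4; Kudla94 Thm 3.1] (named fact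
`Literature.RepresentationTheory.MoeglinVignerasWaldspurger1987.rankOne_theta_twist_rigidity`, RankOneThetaLiftTwistRigidity.lean :76, p595399; WALL J7 = the cuspidal member).
Consumed by `MuOfIsoNonsplit` as its second binder.  Why it might fail: as a CITE it cannot; the proof needs the first-occurrence / cuspidality input for
`(U(1), U(3))` — XL.  Slot: `:= rankOne_theta_twist_rigidity_holds`.  **v7: CLOSED BY NAME** `:= rankOne_theta_twist_rigidity_holds` (B-p18 p613492). [cite: MoeglinVignerasWaldspurger1987, Ch. 3 IV.4] [cite: Kudla1994, Thm. 3.1] -/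
theorem stub_rankOne_theta_twist_rigidity : Literature.RepresentationTheory.MoeglinVignerasWaldspurger1987.rankOne_theta_twist_rigidity :=
  Literature.RepresentationTheory.MoeglinVignerasWaldspurger1987.rankOne_theta_twist_rigidity_holds   -- v7: CLOSED BY NAME (B-p18 p613492)

/-- **stub (RESIDUAL FACT, row IV-4(c4)) — twist rigidity at a SPLIT place** (type II Howe duality [Mínguez 2008, Thm 1 = Cor. 6.3] + uniqueness of Langlands data
[BZ77, Thm 2.9]; named fact `Literature.RepresentationTheory.MoeglinVignerasWaldspurger1987.rankOne_theta_twist_rigidity_split`, RankOneThetaLiftTwistRigiditySplit.lean :96,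
p598433).  Consumed by `SplitInjective` as its leading binder.  Why it might fail: only through the normalisation of the splitting at split `v` — L.
**v2: CLOSED BY NAME** `:= rankOne_theta_twist_rigidity_split_holds` (B-p17, RankOneThetaLiftTwistRigiditySplitHolds.lean, over B-p08's `splitPlace_chiCoinv_iso_parabolicIndGL_uniform`). [cite: Minguez2008, Thm. 1, Cor. 6.3] [cite: BernsteinZelevinsky1977, Thm. 2.9] -/
theorem stub_rankOne_theta_twist_rigidity_split : Literature.RepresentationTheory.MoeglinVignerasWaldspurger1987.rankOne_theta_twist_rigidity_split :=
  Literature.RepresentationTheory.MoeglinVignerasWaldspurger1987.rankOne_theta_twist_rigidity_split_holds   -- v2: CLOSED BY NAME (B-p17 RankOneThetaLiftTwistRigiditySplitHolds, over B-p08's `_uniform`)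

/-! ## §3 The sorry-free compositions: the five thirds + the three facts ⇒ [Lem. D.1 (3)] AS PRINTED at `famAtV … e₁ … v` ⇒ `HypD3` (decl of record) -/


set_option maxHeartbeats 2000000 in
/-- **Composition at the family (kernel-checked, B-plan1's `lemD1_3AsPrintedI_of` with the place split; v2: at `e₁`, the three IV-4c facts as arguments feeding the (D1) binders): the five thirds ⇒ [Lem. D.1 (3)] AS PRINTED on
`famAtV … e₁ … v`, by `by_cases hE : IsField (F ⊗ F⁺_v)`.** [cite: Liu2021, App. D Lem. D.1 (3) (l. 5233)] -/
theorem lemD1_3AsPrintedI_famAtV_of (s₁ : SameClassChiOfIsoNonsplit) (s₂ : MuOfIsoNonsplit) (s₃ : SplitInjective) (s₄ : SameClassOfSplit)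
    (s₅ : IsoOfParams) (hc1 : Literature.RepresentationTheory.MoeglinVignerasWaldspurger1987.rankOne_theta_lines_disjoint)
    (hc3 : Literature.RepresentationTheory.MoeglinVignerasWaldspurger1987.rankOne_theta_twist_rigidity)
    (hc4 : Literature.RepresentationTheory.MoeglinVignerasWaldspurger1987.rankOne_theta_twist_rigidity_split)
    (F : HodgeCM.CMField) (dV : Fin 3 → (F : Type))
      (hdV : ∀ i, IsCMField.complexConj (F : Type) (dV i) = dV i) (hdV0 : ∀ i, dV i ≠ 0) {ι : Type}
      (ψ : ι → (Literature.NumberTheory.Automorphic.IdeleClassGroup (F : Type) →ₜ* Circle))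
      (hψ : ∀ t, IdeleClassGroup.IsConjugateSymplectic (F : Type) (ψ t))
      (aOf : ι → (↥(maximalRealSubfield (F : Type)))ˣ)
      (χOf : ι → Def411WeilCarriers.Chi ↥(maximalRealSubfield (F : Type)) (F : Type) (IsCMField.complexConj (F : Type)))
      (v : IsDedekindDomain.HeightOneSpectrum (𝓞 ↥(maximalRealSubfield (F : Type)))) :
    LemD1_3AsPrintedI (famAtV F e₁ dV hdV hdV0 ψ hψ aOf χOf v) := by
  have h₁ := s₁ hc1 F dV hdV hdV0 ψ hψ aOf χOf v
  have h₂ := s₂ hc1 hc3 F dV hdV hdV0 ψ hψ aOf χOf v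
  have h₃ := s₃ hc4 F dV hdV hdV0 ψ hψ aOf χOf v
  have h₄ := @s₄ F dV hdV hdV0 ι ψ hψ aOf χOf v
  have h₅ := @s₅ F dV hdV hdV0 ι ψ hψ aOf χOf v
  intro _ i j
  refine ⟨fun h => ?_, fun h => h₅ i j h.1 h.2.1 h.2.2⟩
  by_cases hE : IsField (UnitaryGroup.LocalRing (F : Type) v)
  · exact ⟨h₂ hE i j h, (h₁ hE i j h).1, (h₁ hE i j h).2⟩
  · exact ⟨(h₃ hE i j h).1, h₄ hE i j, (h₃ hE i j h).2⟩

/-! ## §4 The face: `HypD3` = the pack decl of record BY NAME, the sorry-free head `HypD3_of`, and the GATE-SHAPE HEAD `HD3_proof` -/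

open Summit.HodgeConjecture.CorCM.D2Bridge.MuKeyIdentLemD3DelRecConjOmegaEndT.PrintedCitationHypotheses (HypD3)   -- v2: the decl OF RECORD by name (local copy deleted)

set_option maxHeartbeats 4000000 in
/-- **HEAD COMPOSITION (sorry-free): the five stubs + the three IV-4c facts ⇒ `HypD3`** (decl of record) — instantiate the family at the face (`e ↦ e₁`, `dV ↦ frameD V`,
`ψ t ↦ t.1.1`, `aOf t ↦ r_a(t.2.1.1)`, `χOf t ↦ t.2.1.2`); the body is then `HypD3`'s own `localIndexedFamilyAtV … v` by `rfl`-unfolding of `famAtV`.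
Concludes the target BY NAME.  HC_CM is proved only modulo the 7 printed citations. [cite: Liu2021, App. D Lem. D.1 (3) (l. 5233)] -/
theorem HypD3_of : SameClassChiOfIsoNonsplit → MuOfIsoNonsplit → SplitInjective → SameClassOfSplit → IsoOfParams →
    Literature.RepresentationTheory.MoeglinVignerasWaldspurger1987.rankOne_theta_lines_disjoint →
    Literature.RepresentationTheory.MoeglinVignerasWaldspurger1987.rankOne_theta_twist_rigidity →
    Literature.RepresentationTheory.MoeglinVignerasWaldspurger1987.rankOne_theta_twist_rigidity_split → HypD3 := by
  intro s₁ s₂ s₃ s₄ s₅ hc1 hc3 hc4 hDel F _ h6 ι₁ V a Φ hΦ v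
  exact lemD1_3AsPrintedI_famAtV_of s₁ s₂ s₃ s₄ s₅ hc1 hc3 hc4 F (frameD V) (frameD_real V) (frameD_ne V)
    (fun t : ((μw : {μ : Literature.NumberTheory.Automorphic.IdeleClassGroup (F : Type) →ₜ* Circle // IdeleClassGroup.IsConjugateSymplectic (F : Type) μ ∧ IdeleClassGroup.HasWeight (F : Type) μ 1}) × (toThm418Data _ (restOfCharDeltaPrime (Summit.HodgeConjecture.CorCM.DelRec.exists_recordSystem_of_printed hDel) ⟨HodgeCM.CMField.K F⟩ h6 ι₁ ⟨HodgeCM.HermSpace3.Hm V, HodgeCM.HermSpace3.isHermitian V, HodgeCM.HermSpace3.signature_ι₁ V, HodgeCM.HermSpace3.posDef_of_ne V⟩ Φ e₁ (frameD V) (frameD_real V) (frameD_ne V) (ιVE V) (Rep.update ↥(maximalRealSubfield (HodgeCM.CMField.K F)) (imagUnitSq (HodgeCM.CMField.K F)) (Rep.ofLineOf ↥(maximalRealSubfield (HodgeCM.CMField.K F)) (imagUnitSq (HodgeCM.CMField.K F))) (locF ↥(maximalRealSubfield (HodgeCM.CMField.K F)) (imagUnitSq (HodgeCM.CMField.K F))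 (realUnit ⟨HodgeCM.CMField.K F⟩ a.1 a.2.1 a.2.2)) (realUnit ⟨HodgeCM.CMField.K F⟩ a.1 a.2.1 a.2.2) rfl) μw.1 μw.2.1 μw.2.2)).AdmIndex) => t.1.1) (fun t => t.1.2.1)
    (fun t => (Rep.update ↥(maximalRealSubfield (HodgeCM.CMField.K F)) (imagUnitSq (HodgeCM.CMField.K F)) (Rep.ofLineOf ↥(maximalRealSubfield (HodgeCM.CMField.K F)) (imagUnitSq (HodgeCM.CMField.K F))) (locF ↥(maximalRealSubfield (HodgeCM.CMField.K F)) (imagUnitSq (HodgeCM.CMField.K F)) (realUnit ⟨HodgeCM.CMField.K F⟩ a.1 a.2.1 a.2.2)) (realUnit ⟨HodgeCM.CMField.K F⟩ a.1 a.2.1 a.2.2) rfl).toFun t.2.1.1)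
    (fun t => t.2.1.2) v

/-- AUDIT: the skeleton's output feeds the `hD3` slot of the headline (rows `hLiu418`, `h411`, `h413`, `hD1''` λ-bound with their headline types) — with the
five thirds and the three IV-4c facts, exactly the six OTHER printed citations remain before `HC_CM`.  HC_CM is proved only modulo the 7 printed citations. [cite: Liu2021, App. D Lem. D.1 (3)] -/
example (hDel : Literature.AlgebraicGeometry.ShimuraVarieties.UnitaryCanonicalModel.canonicalModel_exists_printed)
    (h21 : shimura1998_thm21_4_casselman) :=
  fun hLiu418 h411 h413 hD1pp => hc_cm_of_printed_citations_muKey_ident_lemD3_delRecConjOmegaT hDel h21 hLiu418 h411 h413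
    (HypD3_of stub_sameClass_and_chi_of_iso_nonsplit stub_mu_of_iso_nonsplit stub_splitInjective stub_sameClass_of_split stub_iso_of_params
      stub_rankOne_theta_lines_disjoint stub_rankOne_theta_twist_rigidity stub_rankOne_theta_twist_rigidity_split hDel) hD1pp

/-- **`HD3_proof` — GATE-SHAPE HEAD (v2, unchanged in v3/v4; crux stmt-HodgeConjecture-24837 of route `route-HodgeConjecture-HCCMUnconditional`).**  The route item
`HCCMUnconditional.HD3` (= the pack decl `PrintedCitationHypotheses.HypD3` by `rfl`) from `HypD3_of` applied to the five thirds (ALL FIVE CLOSED BY NAME — :190/:195/:203 modulo the ONE place-free residual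
`stub_lineRigidityS6a` (v4), itself CLOSED BY NAME in v6) and the fact stubs c3 (v7: CLOSED BY NAME — B-p18 p613492) ∕ c1 (v5) ∕ c4 (closed by name) — no `sorry` remains; no other route item is used.  HC_CM is proved only modulo the 7 printed citations until rung 0
closes. [cite: Liu2021, App. D Lem. D.1 (3) (l. 5233)] -/
theorem HD3_proof : Summit.HodgeConjecture.HodgeConjecture.Theses.HCCMUnconditional.HD3 :=
  HypD3_of stub_sameClass_and_chi_of_iso_nonsplit stub_mu_of_iso_nonsplit stub_splitInjective stub_sameClass_of_split stub_iso_of_params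
    stub_rankOne_theta_lines_disjoint stub_rankOne_theta_twist_rigidity stub_rankOne_theta_twist_rigidity_split

end Summit.HodgeConjecture.CorCM.Lines.A4LiuD3

end
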